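import Summits.Ventures.PercRepro.RankLevelSetCorankFour
import Summits.Ventures.PercRepro.RankLevelSetCorankFiveCounts
import Summits.Ventures.PercRepro.RankLevelSetTheoremCFull

/-!
# PercRepro — C-025 at `q = 3`, corank `≤ 4`, for every `p ≥ 18` (night-1, gen 2)

`c025_corank_four_simple` (RankLevelSetCorankFour) needed `|E| ≥ 100` only because it bounded the numbers of
`3`- and `4`-element circuits by `C(16, 3) = 560` and `C(16, 4) = 1820` (all small circuits lie in a set of at most
`16` elements, Corollary N′). The cocircuit count of RankLevelSetCocircuitCount gives, on that same set (nullity `≤ 4` by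
`encard_le_eRk_add_of_encard_eq` of RankLevelSetCorankFiveCounts, at most `16` elements), `s₃ ≤ 20` and `s₄ ≤ 35` (`U_{2,6}`, `U_{3,7}`), and the identical proof then closes from
`|E| ≥ 21`: the arithmetic `2^{n−1}(C(n,3) + 20n + 35) + 2·C(n−1,3)·Σ_{j≤7} C(n,j) ≤ 2^n·C(n−1,3)` holds for every
`n ≥ 21` (ratio `0.97` at `n = 21`; it fails at `n = 20`), proved by induction from `n = 21` — each term grows by at
most the factor `2n/(n − 3)` by which the right-hand side grows.

* `ncard_isCircuit_three_le_of_nullity_le_four`, `…_of_subset_nullity_le_four` — `s₃ ≤ 20` at nullity `≤ 4`;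
* `ncard_circuitsEq_three_le_corank_four`, `ncard_circuitsEq_four_le_corank_four` — `s₃ ≤ 20`, `s₄ ≤ 35` at corank `4`;
* `sum_choose_succ_le`, `corank_four_arith_sharp` — the arithmetic from `n = 21`;
* **`c025_corank_four_simple_sharp`** — the simple-core theorem at corank `4` for `|E| ≥ 21`;
* **`c025_three_corank_four_sharp`** — every finite matroid, corank `≤ 4`, `p ≥ 18` (`rls_succ_bounded 2 4 17`; the
  coloop step of the reduction costs one unit of `p`).
Axioms: standard.
-/

namespace PercRepro

namespace Matroid

open Set

variable {α : Type*} {M : _root_.Matroid α}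

/-- **Three-element circuits at nullity `≤ 4`**: a finite matroid on at most `16` elements with `M✶.eRank ≤ 4` has at
most `20` three-element circuits (`20 = C(6, 3)`, `U_{2,6}`). -/
theorem ncard_isCircuit_three_le_of_nullity_le_four (M : _root_.Matroid α) [M.Finite]
    (hE : M.E.ncard ≤ 16) (hν : M✶.eRank ≤ 4) :
    {C | M.IsCircuit C ∧ C.ncard = 3}.ncard ≤ 20 := by
  obtain ⟨ν, hν4, hν'⟩ := exists_nullity_eq_of_le M (n := 4) (by exact_mod_cast hν)
  obtain ⟨c, hc, h⟩ := exists_ncard_isCircuit_mul_choose_le M hν' 3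
  have hc' : c ≤ 16 := hc.trans hE
  generalize {C | M.IsCircuit C ∧ C.ncard = 3}.ncard = s at h ⊢
  interval_cases ν <;> interval_cases c <;>
    norm_num [Nat.choose_eq_factorial_div_factorial, Nat.factorial, Nat.choose_two_right,
      Nat.choose_eq_zero_of_lt] at h ⊢ <;> omega

/-- The same for the `3`-circuits of `M` when they all lie in a set `S` with `|S| ≤ 16` and `|S| ≤ r(S) + 4`. -/
theorem ncard_isCircuit_three_le_of_subset_nullity_le_four (M : _root_.Matroid α) [M.Finite] {S : Set α}
    (hS : S ⊆ M.E) (hcov : ∀ C, M.IsCircuit C → C.ncard = 3 → C ⊆ S) (hSc : S.ncard ≤ 16)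
    (hν : S.encard ≤ M.eRk S + 4) : {C | M.IsCircuit C ∧ C.ncard = 3}.ncard ≤ 20 := by
  haveI : (M.restrict S).Finite := _root_.Matroid.restrict_finite (M.ground_finite.subset hS)
  rw [← setOf_isCircuit_ncard_restrict_eq hS hcov]
  refine ncard_isCircuit_three_le_of_nullity_le_four (M.restrict S) ?_ (dual_eRank_restrict_le hS hν)
  rwa [_root_.Matroid.restrict_ground_eq]

/-- The union `S₀` of the circuits with at most `4` elements, at corank `4`: `S₀ ⊆ E`, `|S₀| ≤ 16`,
`|S₀| ≤ r(S₀) + 4`, and every `3`- or `4`-element circuit lies in it. -/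
theorem sUnion_circuitsLE_four_props [M.Finite] (hd : M.E.encard = M.eRank + 4) :
    ⋃₀ circuitsLE M 4 ⊆ M.E ∧ (⋃₀ circuitsLE M 4).ncard ≤ 16 ∧
      (⋃₀ circuitsLE M 4).encard ≤ M.eRk (⋃₀ circuitsLE M 4) + 4 ∧
      (∀ C, M.IsCircuit C → C.ncard ≤ 4 → C ⊆ ⋃₀ circuitsLE M 4) := by
  have hSE : ⋃₀ circuitsLE M 4 ⊆ M.E := by
    intro x hx
    obtain ⟨C, hC, hxC⟩ := Set.mem_sUnion.1 hx
    exact subset_ground_of_mem_circuitsLE hC hxC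
  have hSfin : (⋃₀ circuitsLE M 4).Finite := M.ground_finite.subset hSE
  refine ⟨hSE, ?_, encard_le_eRk_add_of_encard_eq hSE hd, ?_⟩
  · have h := encard_sUnion_circuitsLE_le (M := M) (k := 4) (d := 4) hd
    rw [← hSfin.cast_ncard_eq] at h
    exact_mod_cast h
  · intro C hC hC4
    refine subset_sUnion_of_mem ⟨hC, ?_⟩
    have hfin : C.Finite := M.ground_finite.subset hC.subset_ground
    rw [← hfin.cast_ncard_eq]
    exact_mod_cast hC4

/-- **`s₃ ≤ 20` at corank `4`.** -/
theorem ncard_circuitsEq_three_le_corank_four [M.Finite] (hd : M.E.encard = M.eRank + 4) :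
    (circuitsEq M 3).ncard ≤ 20 := by
  obtain ⟨hSE, hS16, hν, hcov⟩ := sUnion_circuitsLE_four_props hd
  exact ncard_isCircuit_three_le_of_subset_nullity_le_four M hSE
    (fun C hC h3 => hcov C hC (by omega)) hS16 hν

/-- **`s₄ ≤ 35` at corank `4`.** -/
theorem ncard_circuitsEq_four_le_corank_four [M.Finite] (hd : M.E.encard = M.eRank + 4) :
    (circuitsEq M 4).ncard ≤ 35 := by
  obtain ⟨hSE, hS16, hν, hcov⟩ := sUnion_circuitsLE_four_props hd
  exact ncard_isCircuit_four_le_of_subset_nullity_le_four M hSE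
    (fun C hC h4 => hcov C hC (by omega)) hS16 hν

end Matroid

/-! ### The arithmetic from `n = 21` -/

/-- `Σ_{j<8} C(n+1, j) ≤ 2·Σ_{j<8} C(n, j)` (Pascal). -/
theorem sum_choose_succ_le (n : ℕ) :
    (∑ j ∈ Finset.range 8, (n + 1).choose j) ≤ 2 * ∑ j ∈ Finset.range 8, n.choose j := by
  have h1 : (∑ j ∈ Finset.range 8, (n + 1).choose j) =
      (∑ j ∈ Finset.range 7, n.choose j) + ∑ j ∈ Finset.range 8, n.choose j := by
    have hL : (∑ j ∈ Finset.range 8, (n + 1).choose j) =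
        (∑ j ∈ Finset.range 7, n.choose j) + ((∑ j ∈ Finset.range 7, n.choose (j + 1)) + 1) := by
      rw [Finset.sum_range_succ' (fun j => (n + 1).choose j), Nat.choose_zero_right]
      have hc : ∑ j ∈ Finset.range 7, (n + 1).choose (j + 1) =
          ∑ j ∈ Finset.range 7, (n.choose j + n.choose (j + 1)) :=
        Finset.sum_congr rfl (fun j _ => Nat.choose_succ_succ n j)
      rw [hc, Finset.sum_add_distrib]
      ring
    have hR : (∑ j ∈ Finset.range 8, n.choose j) =
        (∑ j ∈ Finset.range 7, n.choose (j + 1)) + 1 := by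
      rw [Finset.sum_range_succ' (fun j => n.choose j), Nat.choose_zero_right]
    rw [hL, hR]
  have h2 : (∑ j ∈ Finset.range 7, n.choose j) ≤ ∑ j ∈ Finset.range 8, n.choose j :=
    Finset.sum_le_sum_of_subset_of_nonneg (Finset.range_mono (by norm_num))
      (fun _ _ _ => Nat.zero_le _)
  omega

/-- **The corank-`4` arithmetic with the sharp constants**, for every `n ≥ 21`:
`2^{n−1}·(C(n,3) + 20n + 35) + 2·C(n−1,3)·Σ_{j<8} C(n,j) ≤ 2^n·C(n−1,3)`. -/
theorem corank_four_arith_sharp (n : ℕ) (hn : 21 ≤ n) :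
    2 ^ (n - 1) * (n.choose 3 + 20 * n + 35) +
      2 * ((n - 1).choose 3) * (∑ j ∈ Finset.range 8, n.choose j) ≤ 2 ^ n * (n - 1).choose 3 := by
  induction n, hn using Nat.le_induction with
  | base =>
    simp only [Finset.sum_range_succ, Finset.sum_range_zero]
    norm_num [Nat.choose_eq_factorial_div_factorial, Nat.factorial]
  | succ n hn ih =>
    obtain ⟨m, rfl⟩ : ∃ m, n = m + 4 := ⟨n - 4, by omega⟩
    have e1 : m + 4 - 1 = m + 3 := by omega
    have e2 : m + 4 + 1 - 1 = m + 4 := by omega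
    rw [e1] at ih
    rw [e2]
    -- the three binomials
    have h3 : 6 * (m + 3).choose 3 = (m + 1) * (m + 2) * (m + 3) := six_mul_choose_three m
    have h4 : 6 * (m + 4).choose 3 = (m + 2) * (m + 3) * (m + 4) := six_mul_choose_three (m + 1)
    have h5 : 6 * (m + 4 + 1).choose 3 = (m + 3) * (m + 4) * (m + 5) := six_mul_choose_three (m + 2)
    -- `(m+1)·C(m+4,3) = (m+4)·C(m+3,3)` and `(m+1)·C(m+5,3) ≤ (m+4)·C(m+4,3)`
    have hE1 : (m + 1) * (m + 4).choose 3 = (m + 4) * (m + 3).choose 3 := by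
      have : 6 * ((m + 1) * (m + 4).choose 3) = 6 * ((m + 4) * (m + 3).choose 3) := by
        calc 6 * ((m + 1) * (m + 4).choose 3) = (m + 1) * (6 * (m + 4).choose 3) := by ring
          _ = (m + 1) * ((m + 2) * (m + 3) * (m + 4)) := by rw [h4]
          _ = (m + 4) * ((m + 1) * (m + 2) * (m + 3)) := by ring
          _ = (m + 4) * (6 * (m + 3).choose 3) := by rw [h3]
          _ = 6 * ((m + 4) * (m + 3).choose 3) := by ring
      omega
    have hE2 : (m + 1) * (m + 4 + 1).choose 3 ≤ (m + 4) * (m + 4).choose 3 := by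
      have : 6 * ((m + 1) * (m + 4 + 1).choose 3) ≤ 6 * ((m + 4) * (m + 4).choose 3) := by
        calc 6 * ((m + 1) * (m + 4 + 1).choose 3) = (m + 1) * (6 * (m + 4 + 1).choose 3) := by ring
          _ = (m + 1) * ((m + 3) * (m + 4) * (m + 5)) := by rw [h5]
          _ ≤ (m + 4) * ((m + 2) * (m + 3) * (m + 4)) := by nlinarith
          _ = (m + 4) * (6 * (m + 4).choose 3) := by rw [h4]
          _ = 6 * ((m + 4) * (m + 4).choose 3) := by ring
      omega
    have hS := sum_choose_succ_le (m + 4)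
    -- abbreviations
    set X := 2 ^ (m + 3) with hX
    set S := ∑ j ∈ Finset.range 8, (m + 4).choose j with hSdef
    set S' := ∑ j ∈ Finset.range 8, (m + 4 + 1).choose j with hS'def
    set c3 := (m + 3).choose 3 with hc3
    set c4 := (m + 4).choose 3 with hc4
    set c5 := (m + 4 + 1).choose 3 with hc5
    have hp1 : 2 ^ (m + 4) = 2 * X := by rw [hX, pow_succ]; ring
    have hp2 : 2 ^ (m + 4 + 1) = 4 * X := by rw [hX, pow_succ, pow_succ]; ring
    rw [hp1] at ih
    rw [hp1, hp2]
    -- the ratio argument, multiplied by `m + 1`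
    have key : (m + 1) * (2 * X * (c5 + 20 * (m + 4 + 1) + 35) + 2 * c4 * S') ≤
        (m + 1) * (4 * X * c4) := by
      have hA := Nat.mul_le_mul_left (2 * (m + 4)) ih
      have hB := Nat.mul_le_mul_left (2 * (m + 4) * c3) hS
      have hC := Nat.mul_le_mul_left (2 * X) hE2
      have hD : 2 * X * ((m + 1) * (20 * (m + 4 + 1) + 35)) ≤ 2 * X * ((m + 4) * (20 * (m + 4) + 35)) := by
        apply Nat.mul_le_mul_left
        nlinarith
      have hE1' : 2 * c4 * S' * (m + 1) = 2 * (m + 4) * c3 * S' := by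
        calc 2 * c4 * S' * (m + 1) = 2 * S' * ((m + 1) * c4) := by ring
          _ = 2 * S' * ((m + 4) * c3) := by rw [hE1]
          _ = 2 * (m + 4) * c3 * S' := by ring
      have hE1'' : (m + 1) * (4 * X * c4) = 2 * (m + 4) * (2 * X * c3) := by
        calc (m + 1) * (4 * X * c4) = 4 * X * ((m + 1) * c4) := by ring
          _ = 4 * X * ((m + 4) * c3) := by rw [hE1]
          _ = 2 * (m + 4) * (2 * X * c3) := by ring
      nlinarith [hA, hB, hC, hD, hE1', hE1'']
    exact Nat.le_of_mul_le_mul_left key (by omega)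

namespace Matroid

/-- **C-025 at `q = 3` on the simple core of corank `4`, `|E| ≥ 21`**: in a matroid of rank `p` with `|E| = p + 4 ≥ 21`
all of whose circuits have `≥ 3` elements, `Φ(p,3)·#U(p,3) ≤ #Y(p,3)`. The proof of `c025_corank_four_simple` with
`s₃ ≤ 20`, `s₄ ≤ 35` in place of `560`, `1820`. -/
theorem c025_corank_four_simple_sharp {α : Type*} (M : _root_.Matroid α) [M.Finite] (p : ℕ)
    (hn : 21 ≤ M.E.ncard) (hd : M.E.encard = M.eRank + 4) (hR : M.eRank = (p : ℕ∞))
    (hcirc : ∀ C, M.IsCircuit C → 3 ≤ C.encard) :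
    phiK p 3 * (Matroid.topCount M p 3 : ℚ) ≤ (Matroid.midCount M p 3 : ℚ) := by
  classical
  set n := M.E.ncard with hn_def
  have hEcard : M.ground_finite.toFinset.card = n := by
    rw [hn_def, Set.ncard_eq_toFinset_card _ M.ground_finite]
  have hnpd : n = p + 4 := by
    have h := hd
    rw [← M.ground_finite.cast_ncard_eq, hR] at h
    exact_mod_cast h
  -- (U): #U ≤ C(n,3) + 20 n + 35
  have hs3 : (Matroid.circuitsEq M 3).ncard ≤ 20 := ncard_circuitsEq_three_le_corank_four hd
  have hs4 : (Matroid.circuitsEq M 4).ncard ≤ 35 := ncard_circuitsEq_four_le_corank_four hd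
  have hU : Matroid.topCount M p 3 ≤ n.choose 3 + 20 * n + 35 := by
    have h := Matroid.topCount_le_corank_four (M := M) hcirc hd hR
    rw [hEcard] at h
    have h' : (Matroid.circuitsEq M 3).ncard * n ≤ 20 * n := Nat.mul_le_mul_right n hs3
    omega
  -- (Y): 2^n ≤ #Y + Σ_{j ≤ 7} C(n,j) + Σ_{j ≤ 4} C(n,j)
  have hY : 2 ^ n ≤ Matroid.midCount M p 3 + (∑ j ∈ Finset.range 8, n.choose j) +
      (∑ j ∈ Finset.range 5, n.choose j) := by
    have h := Matroid.two_pow_le_midCount_add (M := M) p 3 hR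
    have hA := Matroid.ncard_eRk_le_le (M := M) (q := 3) (d := 4) hd
    have hB := Matroid.ncard_spanning_le (M := M) (d := 4) hd
    rw [hEcard] at h hA hB
    rw [show (3 + 4 + 1 : ℕ) = 8 from rfl] at hA
    rw [show (4 + 1 : ℕ) = 5 from rfl] at hB
    omega
  have hB' : (∑ j ∈ Finset.range 5, n.choose j) ≤ ∑ j ∈ Finset.range 8, n.choose j :=
    Finset.sum_le_sum_of_subset_of_nonneg (Finset.range_mono (by norm_num : 5 ≤ 8))
      (fun _ _ _ => Nat.zero_le _)
  -- (Φ): Φ(p,3) ≤ 2^{n−1} / C(n−1,3)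
  have hΦ := phiK_le_two_pow_div p 3
  have hp3 : p + 3 = n - 1 := by omega
  have hchoose : (n - 1).choose p = (n - 1).choose 3 := by
    have hp : p = n - 1 - 3 := by omega
    conv_lhs => rw [hp]
    exact Nat.choose_symm (by omega)
  rw [hp3, hchoose] at hΦ
  -- the arithmetic
  have harith := corank_four_arith_sharp n hn
  have hc : (0 : ℚ) < ((n - 1).choose 3 : ℚ) := by exact_mod_cast Nat.choose_pos (by omega)
  -- to the rationals
  have h1 : ((2 ^ (n - 1) * (n.choose 3 + 20 * n + 35) +
      2 * ((n - 1).choose 3) * (∑ j ∈ Finset.range 8, n.choose j) : ℕ) : ℚ) ≤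
      ((2 ^ n * (n - 1).choose 3 : ℕ) : ℚ) := by exact_mod_cast harith
  have h2 : ((2 ^ n : ℕ) : ℚ) ≤ ((Matroid.midCount M p 3 + (∑ j ∈ Finset.range 8, n.choose j) +
      (∑ j ∈ Finset.range 5, n.choose j) : ℕ) : ℚ) := by exact_mod_cast hY
  have h3 : (((∑ j ∈ Finset.range 5, n.choose j : ℕ)) : ℚ) ≤
      (((∑ j ∈ Finset.range 8, n.choose j : ℕ)) : ℚ) := by exact_mod_cast hB'
  have hUq : (Matroid.topCount M p 3 : ℚ) ≤ ((n.choose 3 + 20 * n + 35 : ℕ) : ℚ) := by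
    exact_mod_cast hU
  push_cast at h1 h2 h3 hUq
  have key : (2 : ℚ) ^ (n - 1) * ((n.choose 3 : ℚ) + 20 * n + 35) ≤
      ((n - 1).choose 3 : ℚ) * (Matroid.midCount M p 3 : ℚ) := by
    nlinarith [h1, h2, h3, hc]
  calc phiK p 3 * (Matroid.topCount M p 3 : ℚ)
      ≤ ((2 : ℚ) ^ (n - 1) / ((n - 1).choose 3 : ℚ)) * (Matroid.topCount M p 3 : ℚ) :=
        mul_le_mul_of_nonneg_right hΦ (by positivity)
    _ ≤ ((2 : ℚ) ^ (n - 1) / ((n - 1).choose 3 : ℚ)) * ((n.choose 3 : ℚ) + 20 * n + 35) :=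
        mul_le_mul_of_nonneg_left hUq (by positivity)
    _ ≤ (Matroid.midCount M p 3 : ℚ) := by
        rw [div_mul_eq_mul_div, div_le_iff₀ hc]
        linarith [key]

end Matroid

namespace ThmN

variable {α : Type}

/-- **C-025 at `q = 3`, corank `≤ 4`, for every `p ≥ 18`**: every finite matroid `M` and every `p ≥ 18` with
`|E| ≤ p + 4` satisfy `Φ(p,3)·#U(p,3) ≤ #Y(p,3)` — no simplicity, no rank condition, coloops allowed
(`rls_succ_bounded 2 4 17` with Theorem N at level `2` and `c025_corank_four_simple_sharp` on the core, whose
`|E| = p' + 4 ≥ 21` needs `p' ≥ 17`). -/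
theorem c025_three_corank_four_sharp (M : Matroid α) [M.Finite] (p : ℕ) (hp : 18 ≤ p)
    (hD : M.E.ncard ≤ p + 4) : RLS M p 3 := by
  have h := rls_succ_bounded (α := α) 2 4 17
    (fun M' _ p' _ _ hp' => c025_two_all M' p' (by omega))
    (fun M' _ p' d hP' hd hdD hEd hR _ hc => by
      have hd4 : d = 4 := by omega
      subst hd4
      have hn : M'.E.ncard = p' + 4 := by
        have h := hEd
        rw [← M'.ground_finite.cast_ncard_eq, hR] at h
        exact_mod_cast h
      rw [RLS_iff]
      exact Matroid.c025_corank_four_simple_sharp M' p' (by omega) hEd hR hc)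
    M p (by omega) hD (by omega)
  exact h

end ThmN

end PercRepro
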